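import Summits.ValiantsHypothesis.ValiantsHypothesis.Theorems.MonotoneRestorationOrbitRestorationQPCatalecticantRestoration
import HarnessLib

/-!
# Calculus of derivative chains: sums, scalars, products (catalecticant rank is subadditive and submultiplicative)

Route MonotoneRestoration, crux `OrbitRestorationQP` (stmt-ValiantsHypothesis-18293), line `depth-three-rung`,
stub A_∞ `stub_sigmaPiSigmaValue`.  Namespace `Summit.ValiantsHypothesis.ValiantsHypothesis.Theorems.DerivativeTower`.

`…CatalecticantRestoration.lean` restores every matrix-symmetric family of polynomial catalecticant rank
(`finrank (derivChain (f n) m) ≤ n^c + c`).  To make that class usable compositionally this file proves the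
closure rules of derivative chains:

* `derivChain_add_le`, `derivChain_C_mul_le`, `derivChain_sum_le` — chains of sums / scalar multiples lie in
  the sup of the chains;
* `derivChain_mul_le` — Leibniz: `derivChain (f g) m ≤ ⨆_{a ≤ m} derivChain f a * derivChain g (m − a)`;
* `finrank_mul_le_of_submodule` — `finrank (M * N) ≤ finrank M * finrank N` for finite-dimensional submodules
  of an algebra; `finrank_derivChain_add_le`, `finrank_derivChain_mul_le` — the resulting dimension bounds.

So sums of polynomially many and products of boundedly many polynomials of polynomial catalecticant rank have
polynomial catalecticant rank (e.g. `Σ_i Π_{j<t} (affine form)^{e_ij}`, `t` bounded).  Everything is proved.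
[folklore]
-/

noncomputable section

open scoped Classical Pointwise

-- `Summit.ValiantsHypothesis.ValiantsHypothesis.…` is the tree's single-conjunct layout (Sub = Summit).
set_option linter.dupNamespace false

namespace Summit.ValiantsHypothesis.ValiantsHypothesis.Theorems

namespace DerivativeTower

open MvPolynomial Finset Equiv OrbitRestorationQPDepthThreeRung WaringJennrich LevelStructure

variable {n : ℕ}

/-- The successor level of a chain is generated by the partial derivatives of the previous level: a
submodule containing all `∂_x p`, `p ∈ derivChain f m`, contains `derivChain f (m+1)`. [folklore] -/
theorem derivChain_succ_le {f : MvPolynomial (Fin n × Fin n) ℂ} {m : ℕ}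
    {P : Submodule ℂ (MvPolynomial (Fin n × Fin n) ℂ)}
    (h : ∀ p ∈ derivChain f m, ∀ x : Fin n × Fin n, pderiv x p ∈ P) : derivChain f (m + 1) ≤ P := by
  show Submodule.span ℂ {q | ∃ (x : Fin n × Fin n) (p : MvPolynomial (Fin n × Fin n) ℂ),
      p ∈ derivChain f m ∧ q = pderiv x p} ≤ P
  rw [Submodule.span_le]
  rintro _ ⟨x, p, hp, rfl⟩
  exact h p hp x

/-- Level `0` of a chain is the line through `f`. [folklore] -/
theorem derivChain_zero_eq (f : MvPolynomial (Fin n × Fin n) ℂ) : derivChain f 0 = Submodule.span ℂ {f} := rfl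

/-- **Chains of sums.** [folklore] -/
theorem derivChain_add_le (f g : MvPolynomial (Fin n × Fin n) ℂ) :
    ∀ m : ℕ, derivChain (f + g) m ≤ derivChain f m ⊔ derivChain g m
  | 0 => by
      rw [derivChain_zero_eq, Submodule.span_le, Set.singleton_subset_iff, SetLike.mem_coe]
      exact Submodule.add_mem_sup (mem_derivChain_zero f) (mem_derivChain_zero g)
  | m + 1 => by
      refine derivChain_succ_le fun p hp x => ?_
      obtain ⟨p₁, hp₁, p₂, hp₂, rfl⟩ := Submodule.mem_sup.mp (derivChain_add_le f g m hp)
      rw [map_add]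
      exact Submodule.add_mem_sup (pderiv_mem_derivChain hp₁ x) (pderiv_mem_derivChain hp₂ x)

/-- **Chains of scalar multiples.** [folklore] -/
theorem derivChain_C_mul_le (a : ℂ) (f : MvPolynomial (Fin n × Fin n) ℂ) :
    ∀ m : ℕ, derivChain (C a * f) m ≤ derivChain f m
  | 0 => by
      rw [derivChain_zero_eq, Submodule.span_le, Set.singleton_subset_iff, SetLike.mem_coe, ← smul_eq_C_mul]
      exact Submodule.smul_mem _ a (mem_derivChain_zero f)
  | m + 1 => by
      refine derivChain_succ_le fun p hp x => ?_
      exact pderiv_mem_derivChain (derivChain_C_mul_le a f m hp) x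

/-- The chain of `0` is trivial. [folklore] -/
theorem derivChain_zero_poly : ∀ m : ℕ, derivChain (0 : MvPolynomial (Fin n × Fin n) ℂ) m = ⊥
  | 0 => by rw [derivChain_zero_eq, Submodule.span_singleton_eq_bot]
  | m + 1 => by
      rw [eq_bot_iff]
      refine derivChain_succ_le fun p hp x => ?_
      rw [derivChain_zero_poly m, Submodule.mem_bot] at hp
      rw [hp, map_zero]
      exact Submodule.zero_mem _

/-- **Chains of finite sums.** [folklore] -/
theorem derivChain_sum_le {ι : Type*} (s : Finset ι) (f : ι → MvPolynomial (Fin n × Fin n) ℂ) (m : ℕ) :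
    derivChain (∑ i ∈ s, f i) m ≤ ⨆ i ∈ s, derivChain (f i) m := by
  induction s using Finset.induction_on with
  | empty => rw [Finset.sum_empty, derivChain_zero_poly]; exact bot_le
  | insert a s ha ih =>
    rw [Finset.sum_insert ha, Finset.iSup_insert]
    exact (derivChain_add_le _ _ m).trans (sup_le_sup_left ih _)

/-- **Leibniz for chains.** [folklore] -/
theorem derivChain_mul_le (f g : MvPolynomial (Fin n × Fin n) ℂ) :
    ∀ m : ℕ, derivChain (f * g) m ≤ ⨆ a ∈ Finset.range (m + 1), derivChain f a * derivChain g (m - a)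
  | 0 => by
      rw [derivChain_zero_eq, Submodule.span_le, Set.singleton_subset_iff, SetLike.mem_coe]
      have h : f * g ∈ derivChain f 0 * derivChain g (0 - 0) :=
        Submodule.mul_mem_mul (mem_derivChain_zero f) (mem_derivChain_zero g)
      exact (le_iSup₂ (f := fun a _ => derivChain f a * derivChain g (0 - a)) 0 (by simp)) h
  | m + 1 => by
      refine derivChain_succ_le fun p hp x => ?_
      have hp' := derivChain_mul_le f g m hp
      -- the target is a submodule; reduce to generators `u * v`
      suffices hgen : ∀ a ∈ Finset.range (m + 1), derivChain f a * derivChain g (m - a) ≤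
          (⨆ a ∈ Finset.range (m + 1 + 1), derivChain f a * derivChain g (m + 1 - a)).comap (pdLin x) by
        have := (iSup₂_le hgen) hp'
        exact this
      intro a ha
      rw [Finset.mem_range] at ha
      rw [Submodule.mul_le]
      intro u hu v hv
      show pderiv x (u * v) ∈ ⨆ a ∈ Finset.range (m + 1 + 1), derivChain f a * derivChain g (m + 1 - a)
      rw [pderiv_mul]
      refine Submodule.add_mem _ ?_ ?_
      · have h1 : pderiv x u * v ∈ derivChain f (a + 1) * derivChain g (m + 1 - (a + 1)) := by
          rw [show m + 1 - (a + 1) = m - a by omega]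
          exact Submodule.mul_mem_mul (pderiv_mem_derivChain hu x) hv
        exact (le_iSup₂ (f := fun a _ => derivChain f a * derivChain g (m + 1 - a)) (a + 1)
          (Finset.mem_range.2 (by omega))) h1
      · have h2 : u * pderiv x v ∈ derivChain f a * derivChain g (m + 1 - a) := by
          rw [show m + 1 - a = m - a + 1 by omega]
          exact Submodule.mul_mem_mul hu (pderiv_mem_derivChain hv x)
        exact (le_iSup₂ (f := fun a _ => derivChain f a * derivChain g (m + 1 - a)) a
          (Finset.mem_range.2 (by omega))) h2

/-! ### Dimension bounds -/

/-- `finrank (M * N) ≤ finrank M * finrank N` for finite-dimensional submodules of a commutative algebra, and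
`M * N` is finite-dimensional. [folklore] -/
theorem finrank_mul_le_of_submodule {A : Type*} [CommRing A] [Algebra ℂ A] (M N : Submodule ℂ A)
    [FiniteDimensional ℂ M] [FiniteDimensional ℂ N] :
    FiniteDimensional ℂ ↥(M * N) ∧ Module.finrank ℂ ↥(M * N) ≤ Module.finrank ℂ M * Module.finrank ℂ N := by
  -- finite spanning sets of the right size from bases
  let bM := Module.finBasis ℂ M
  let bN := Module.finBasis ℂ N
  let S : Finset A := Finset.univ.image fun i => (bM i : A)
  let T : Finset A := Finset.univ.image fun i => (bN i : A)
  have hS : Submodule.span ℂ (S : Set A) = M := by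
    apply le_antisymm
    · rw [Submodule.span_le]; intro x hx
      obtain ⟨i, -, rfl⟩ := Finset.mem_image.mp (Finset.mem_coe.mp hx)
      exact (bM i).2
    · intro x hx
      have hx' : (⟨x, hx⟩ : M) ∈ Submodule.span ℂ (Set.range bM) := by rw [bM.span_eq]; trivial
      have := Submodule.apply_mem_span_image_of_mem_span M.subtype hx'
      rw [← Set.range_comp] at this
      refine Submodule.span_mono ?_ this
      rintro _ ⟨i, rfl⟩
      exact Finset.mem_coe.mpr (Finset.mem_image.mpr ⟨i, Finset.mem_univ _, rfl⟩)
  have hT : Submodule.span ℂ (T : Set A) = N := by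
    apply le_antisymm
    · rw [Submodule.span_le]; intro x hx
      obtain ⟨i, -, rfl⟩ := Finset.mem_image.mp (Finset.mem_coe.mp hx)
      exact (bN i).2
    · intro x hx
      have hx' : (⟨x, hx⟩ : N) ∈ Submodule.span ℂ (Set.range bN) := by rw [bN.span_eq]; trivial
      have := Submodule.apply_mem_span_image_of_mem_span N.subtype hx'
      rw [← Set.range_comp] at this
      refine Submodule.span_mono ?_ this
      rintro _ ⟨i, rfl⟩
      exact Finset.mem_coe.mpr (Finset.mem_image.mpr ⟨i, Finset.mem_univ _, rfl⟩)
  have hMN : M * N = Submodule.span ℂ ((S * T : Finset A) : Set A) := by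
    rw [← hS, ← hT, Submodule.span_mul_span, Finset.coe_mul]
  have hcardS : S.card ≤ Module.finrank ℂ M :=
    Finset.card_image_le.trans (by rw [Finset.card_univ, Fintype.card_fin])
  have hcardT : T.card ≤ Module.finrank ℂ N :=
    Finset.card_image_le.trans (by rw [Finset.card_univ, Fintype.card_fin])
  rw [hMN]
  refine ⟨inferInstance, ?_⟩
  calc Module.finrank ℂ ↥(Submodule.span ℂ ((S * T : Finset A) : Set A)) ≤ (S * T).card :=
        finrank_span_finset_le_card _
    _ ≤ S.card * T.card := Finset.card_mul_le
    _ ≤ Module.finrank ℂ M * Module.finrank ℂ N := Nat.mul_le_mul hcardS hcardT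

/-- **Catalecticant rank is subadditive.** [folklore] -/
theorem finrank_derivChain_add_le (f g : MvPolynomial (Fin n × Fin n) ℂ) (m : ℕ)
    [FiniteDimensional ℂ (derivChain f m)] [FiniteDimensional ℂ (derivChain g m)] :
    FiniteDimensional ℂ (derivChain (f + g) m) ∧
      Module.finrank ℂ (derivChain (f + g) m) ≤
        Module.finrank ℂ (derivChain f m) + Module.finrank ℂ (derivChain g m) := by
  have hle := derivChain_add_le f g m
  exact ⟨Submodule.finiteDimensional_of_le hle,
    (Submodule.finrank_mono hle).trans (Submodule.finrank_add_le_finrank_add_finrank _ _)⟩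

/-- `finrank (⨆_{a ∈ s} W a) ≤ Σ_{a ∈ s} finrank (W a)` for finite-dimensional `W a` (the ambient space need
not be finite-dimensional), with finite-dimensionality of the sup. [folklore] -/
theorem finrank_biSup_le_sum {V : Type*} [AddCommGroup V] [Module ℂ V] {ι : Type*} (s : Finset ι)
    (W : ι → Submodule ℂ V) (hW : ∀ a ∈ s, FiniteDimensional ℂ (W a)) :
    FiniteDimensional ℂ ↥(⨆ a ∈ s, W a) ∧ Module.finrank ℂ ↥(⨆ a ∈ s, W a) ≤ ∑ a ∈ s, Module.finrank ℂ (W a) := by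
  induction s using Finset.induction_on with
  | empty =>
    have h0 : (⨆ a ∈ (∅ : Finset ι), W a) = ⊥ := by simp
    refine ⟨by rw [h0]; infer_instance, ?_⟩
    rw [h0, finrank_bot, Finset.sum_empty]
  | insert a s ha ih =>
    obtain ⟨hfin, hle⟩ := ih fun b hb => hW b (Finset.mem_insert_of_mem hb)
    haveI := hfin
    haveI := hW a (Finset.mem_insert_self a s)
    rw [Finset.iSup_insert, Finset.sum_insert ha]
    exact ⟨inferInstance, (Submodule.finrank_add_le_finrank_add_finrank _ _).trans (Nat.add_le_add_left hle _)⟩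

/-- **Catalecticant rank is submultiplicative (Leibniz).** [folklore] -/
theorem finrank_derivChain_mul_le (f g : MvPolynomial (Fin n × Fin n) ℂ) (m : ℕ)
    (hf : ∀ a, FiniteDimensional ℂ (derivChain f a)) (hg : ∀ b, FiniteDimensional ℂ (derivChain g b)) :
    FiniteDimensional ℂ (derivChain (f * g) m) ∧
      Module.finrank ℂ (derivChain (f * g) m) ≤
        ∑ a ∈ Finset.range (m + 1), Module.finrank ℂ (derivChain f a) * Module.finrank ℂ (derivChain g (m - a)) := by
  have hle := derivChain_mul_le f g m
  have hprod : ∀ a ∈ Finset.range (m + 1), FiniteDimensional ℂ ↥(derivChain f a * derivChain g (m - a)) :=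
    fun a _ => by
      haveI := hf a; haveI := hg (m - a)
      exact (finrank_mul_le_of_submodule _ _).1
  obtain ⟨hfin, hsum⟩ := finrank_biSup_le_sum (Finset.range (m + 1))
    (fun a => derivChain f a * derivChain g (m - a)) hprod
  haveI := hfin
  refine ⟨Submodule.finiteDimensional_of_le hle, (Submodule.finrank_mono hle).trans (hsum.trans ?_)⟩
  refine Finset.sum_le_sum fun a _ => ?_
  haveI := hf a; haveI := hg (m - a)
  exact (finrank_mul_le_of_submodule _ _).2

end DerivativeTower

end Summit.ValiantsHypothesis.ValiantsHypothesis.Theorems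

end
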